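import Mathlib
import Literature.Analysis.InnerProduct.GramHadamard
import HarnessLib

/-!
# The difference of two Gram determinants: `|det ⟪f_i, g_j⟫ − det ⟪f'_i, g'_j⟫| ≤ (Σ_{ij} |⟪f_i,g_j⟫ − ⟪f'_i,g'_j⟫|)·(√2 κ_f κ_g)^{n−1}`

Topic `Analysis/Matrix` (companion of `Literature/Analysis/InnerProduct/GramHadamard`).  The two Gram families may live in DIFFERENT inner
product spaces `E₁`, `E₂` (two volumes, two cutoffs, two covariances): the estimate is the Gram–Hadamard inequality applied to the HYBRID
minors, whose rows come from either family and whose columns are the pairs `(g_j, g'_j)` in the `L²` product `E₁ × E₂` (norm `≤ √2 κ_g`),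
after telescoping the rows one at a time and expanding the difference row by Laplace.  This is the loop-line step of every two-volume /
two-cutoff comparison of a fermionic tree expansion (the loop lines sit in a Gram-bounded determinant; Benfatto–Giuliani–Mastropietro 2006
(2.80), de Siqueira Pedra–Salmhofer 2008 Thm 1.3): replacing the covariance entrywise costs `Σ|ΔC|` times the SAME determinant constant up to
`√2` per column — no `n!`.

* (private) telescoping over row hybrids `of (fun i j => if i < k then A i j else B i j)`: two consecutive hybrids differ by the determinant with ONE difference row;
* `norm_det_inner_hybridMinor_le` — Gram–Hadamard for a hybrid minor in `WithLp 2 (E₁ × E₂)`;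
* **`norm_det_inner_sub_det_inner_le`** — the estimate, square matrices indexed by `Fin n`;
* `norm_det_inner_sub_det_inner_le_of_forall_le` — the form with a uniform entrywise bound `δ`: `≤ n²·δ·(√2 κ_f κ_g)^{n−1}`.

Everything is proved; no definition; no named fact.

## Sources
G. Benfatto, A. Giuliani, V. Mastropietro, Ann. Henri Poincaré 7 (2006) 809–898, (2.80) [`BenfattoGiulianiMastropietro2006`];
W. de Siqueira Pedra, M. Salmhofer, Comm. Math. Phys. 282 (2008) 797–818, Thm 1.3 [`PedraSalmhofer2008`];
V. Mastropietro, *Non-Perturbative Renormalization* (2008), Lemma 2.2 [`Mastropietro2008`].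
-/

noncomputable section

open Finset Matrix
open scoped InnerProductSpace

namespace Literature.Analysis.Matrix

variable {𝕜 : Type*} [RCLike 𝕜]
variable {E₁ : Type*} [NormedAddCommGroup E₁] [InnerProductSpace 𝕜 E₁]
variable {E₂ : Type*} [NormedAddCommGroup E₂] [InnerProductSpace 𝕜 E₂]

/-! ### Row hybrids of two matrices -/

/- The HYBRID of two square matrices (rows of index `< k` from `A`, the others from `B`) is written inline as
`Matrix.of fun (i j : Fin n) => if (i : ℕ) < k then A i j else B i j` (no definition is introduced). -/

omit [RCLike 𝕜] in
/-- `(Matrix.of fun (i j : Fin n) => if (i : ℕ) < 0 then A i j else B i j) = B`. [folklore] -/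
private theorem hybrid_zero {n : ℕ} (A B : Matrix (Fin n) (Fin n) 𝕜) : (Matrix.of fun (i j : Fin n) => if (i : ℕ) < 0 then A i j else B i j) = B := by
  ext i j; simp

omit [RCLike 𝕜] in
/-- `(Matrix.of fun (i j : Fin n) => if (i : ℕ) < n then A i j else B i j) = A`. [folklore] -/
private theorem hybrid_self {n : ℕ} (A B : Matrix (Fin n) (Fin n) 𝕜) : (Matrix.of fun (i j : Fin n) => if (i : ℕ) < n then A i j else B i j) = A := by
  ext i j; simp

omit [RCLike 𝕜] in
/-- The next hybrid is the previous one with row `k` replaced by the row of `A`. [folklore] -/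
private theorem hybrid_succ_eq_updateRow {n : ℕ} (A B : Matrix (Fin n) (Fin n) 𝕜) (k : Fin n) :
    (Matrix.of fun (i j : Fin n) => if (i : ℕ) < (k : ℕ) + 1 then A i j else B i j) = ((Matrix.of fun (i j : Fin n) => if (i : ℕ) < (k : ℕ) then A i j else B i j)).updateRow k (A k) := by
  ext i j
  by_cases hik : i = k
  · subst hik
    simp
  · have hne : (i : ℕ) ≠ k := fun h => hik (Fin.ext h)
    rw [updateRow_ne hik]
    simp only [of_apply]
    have : ((i : ℕ) < (k : ℕ) + 1) ↔ ((i : ℕ) < k) := by omega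
    simp only [this]

omit [RCLike 𝕜] in
/-- The previous hybrid is itself with row `k` replaced by the row of `B`. [folklore] -/
private theorem hybrid_eq_updateRow {n : ℕ} (A B : Matrix (Fin n) (Fin n) 𝕜) (k : Fin n) :
    (Matrix.of fun (i j : Fin n) => if (i : ℕ) < (k : ℕ) then A i j else B i j) = ((Matrix.of fun (i j : Fin n) => if (i : ℕ) < (k : ℕ) then A i j else B i j)).updateRow k (B k) := by
  have hrow : ((Matrix.of fun (i j : Fin n) => if (i : ℕ) < (k : ℕ) then A i j else B i j)) k = B k := by
    ext j; simp
  conv_lhs => rw [← updateRow_eq_self ((Matrix.of fun (i j : Fin n) => if (i : ℕ) < (k : ℕ) then A i j else B i j)) k, hrow]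

/-- **Telescoping step**: `det (hybrid (k+1)) − det (hybrid k) = det (hybrid k with row k := A k − B k)` (multilinearity in row `k`).
[folklore] -/
private theorem det_hybrid_succ_sub {n : ℕ} (A B : Matrix (Fin n) (Fin n) 𝕜) (k : Fin n) :
    ((Matrix.of fun (i j : Fin n) => if (i : ℕ) < (k : ℕ) + 1 then A i j else B i j)).det - ((Matrix.of fun (i j : Fin n) => if (i : ℕ) < (k : ℕ) then A i j else B i j)).det = (((Matrix.of fun (i j : Fin n) => if (i : ℕ) < (k : ℕ) then A i j else B i j)).updateRow k (A k - B k)).det := by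
  rw [hybrid_succ_eq_updateRow, sub_eq_add_neg (A k) (B k), det_updateRow_add,
    show -B k = (-1 : 𝕜) • B k by simp, det_updateRow_smul]
  conv_lhs => rw [hybrid_eq_updateRow A B k, updateRow_idem]
  ring

/-- **Telescoping**: `det A − det B = Σ_{k<n} (det hybrid (k+1) − det hybrid k)`. [folklore] -/
private theorem det_sub_det_eq_sum_hybrid {n : ℕ} (A B : Matrix (Fin n) (Fin n) 𝕜) :
    A.det - B.det = ∑ k : Fin n, (((Matrix.of fun (i j : Fin n) => if (i : ℕ) < (k : ℕ) then A i j else B i j)).updateRow k (A k - B k)).det := by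
  have htel := Finset.sum_range_sub (fun k : ℕ => (Matrix.of fun (i j : Fin n) => if (i : ℕ) < k then A i j else B i j).det) n
  rw [hybrid_self, hybrid_zero] at htel
  rw [← htel, ← Fin.sum_univ_eq_sum_range]
  exact Finset.sum_congr rfl fun k _ => det_hybrid_succ_sub A B k

/-! ### Gram–Hadamard for hybrid minors -/

/-- **Gram–Hadamard for a hybrid minor.**  Rows `r` carry either `⟪f₁ (ρ r), g₁ ·⟫` or `⟪f₂ (ρ r), g₂ ·⟫` (according to `P r`), columns are
indexed through `γ`; all `‖f‖ ≤ κf`, `‖g‖ ≤ κg`.  Then `‖det‖ ≤ (√2·κf·κg)^m`: the minor is the Gram matrix of `(f₁,0)`/`(0,f₂)` against `(g₁,g₂)` in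
`WithLp 2 (E₁ × E₂)`. [cite: Mastropietro2008, Lemma 2.2 eq. (2.66)] -/
theorem norm_det_inner_hybridMinor_le {m n : ℕ} (f₁ g₁ : Fin n → E₁) (f₂ g₂ : Fin n → E₂) {κf κg : ℝ}
    (hf₁ : ∀ i, ‖f₁ i‖ ≤ κf) (hf₂ : ∀ i, ‖f₂ i‖ ≤ κf) (hg₁ : ∀ j, ‖g₁ j‖ ≤ κg) (hg₂ : ∀ j, ‖g₂ j‖ ≤ κg) (hκf : 0 ≤ κf) (hκg : 0 ≤ κg)
    (P : Fin m → Prop) [DecidablePred P] (ρ γ : Fin m → Fin n) :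
    ‖(Matrix.of fun r c => if P r then ⟪f₁ (ρ r), g₁ (γ c)⟫_𝕜 else ⟪f₂ (ρ r), g₂ (γ c)⟫_𝕜).det‖ ≤ (Real.sqrt 2 * κf * κg) ^ m := by
  -- the hybrid vectors in the `L²` product
  set F : Fin m → WithLp 2 (E₁ × E₂) := fun r => if P r then WithLp.toLp 2 (f₁ (ρ r), 0) else WithLp.toLp 2 (0, f₂ (ρ r)) with hF
  set G : Fin m → WithLp 2 (E₁ × E₂) := fun c => WithLp.toLp 2 (g₁ (γ c), g₂ (γ c)) with hG
  have hentry : (Matrix.of fun r c => if P r then ⟪f₁ (ρ r), g₁ (γ c)⟫_𝕜 else ⟪f₂ (ρ r), g₂ (γ c)⟫_𝕜) =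
      Matrix.of fun r c => ⟪F r, G c⟫_𝕜 := by
    ext r c
    simp only [of_apply, hF, hG]
    split_ifs with h
    · simp [WithLp.prod_inner_apply]
    · simp [WithLp.prod_inner_apply]
  rw [hentry]
  refine (Literature.Analysis.InnerProduct.norm_det_inner_le_prod_norm_mul_prod_norm F G).trans ?_
  have hFle : ∀ r, ‖F r‖ ≤ κf := by
    intro r
    simp only [hF]
    split_ifs
    · rw [WithLp.norm_toLp_fst]; exact hf₁ _
    · rw [WithLp.norm_toLp_snd]; exact hf₂ _
  have hGle : ∀ c, ‖G c‖ ≤ Real.sqrt 2 * κg := by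
    intro c
    simp only [hG]
    rw [WithLp.prod_norm_eq_of_L2]
    simp only [WithLp.toLp_fst, WithLp.toLp_snd]
    have h1 : ‖g₁ (γ c)‖ ^ 2 ≤ κg ^ 2 := pow_le_pow_left₀ (norm_nonneg _) (hg₁ _) 2
    have h2 : ‖g₂ (γ c)‖ ^ 2 ≤ κg ^ 2 := pow_le_pow_left₀ (norm_nonneg _) (hg₂ _) 2
    calc Real.sqrt (‖g₁ (γ c)‖ ^ 2 + ‖g₂ (γ c)‖ ^ 2) ≤ Real.sqrt (2 * κg ^ 2) :=
          Real.sqrt_le_sqrt (by linarith)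
      _ = Real.sqrt 2 * κg := by
          rw [Real.sqrt_mul' _ (sq_nonneg κg), Real.sqrt_sq hκg]
  calc (∏ r, ‖F r‖) * ∏ c, ‖G c‖ ≤ (∏ _r : Fin m, κf) * ∏ _c : Fin m, (Real.sqrt 2 * κg) :=
        mul_le_mul (prod_le_prod (fun r _ => norm_nonneg _) fun r _ => hFle r)
          (prod_le_prod (fun c _ => norm_nonneg _) fun c _ => hGle c)
          (prod_nonneg fun c _ => norm_nonneg _) (prod_nonneg fun r _ => hκf)
    _ = (Real.sqrt 2 * κf * κg) ^ m := by
        rw [prod_const, prod_const, card_univ, Fintype.card_fin, ← mul_pow]; ring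

/-! ### The estimate -/

/-- **The difference of two Gram determinants** (families in possibly different inner product spaces):
`‖det[⟪f₁ i, g₁ j⟫] − det[⟪f₂ i, g₂ j⟫]‖ ≤ (Σ_i Σ_j ‖⟪f₁ i, g₁ j⟫ − ⟪f₂ i, g₂ j⟫‖) · (√2·κf·κg)^m` for `(m+1) × (m+1)` matrices with
`‖f‖ ≤ κf`, `‖g‖ ≤ κg` (telescoping over rows, Laplace expansion of the difference row, Gram–Hadamard on the hybrid minors).
[cite: BenfattoGiulianiMastropietro2006, (2.80)] -/
theorem norm_det_inner_sub_det_inner_le_succ {m : ℕ} (f₁ g₁ : Fin (m + 1) → E₁) (f₂ g₂ : Fin (m + 1) → E₂) {κf κg : ℝ}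
    (hf₁ : ∀ i, ‖f₁ i‖ ≤ κf) (hf₂ : ∀ i, ‖f₂ i‖ ≤ κf) (hg₁ : ∀ j, ‖g₁ j‖ ≤ κg) (hg₂ : ∀ j, ‖g₂ j‖ ≤ κg) :
    ‖(Matrix.of fun i j => ⟪f₁ i, g₁ j⟫_𝕜).det - (Matrix.of fun i j => ⟪f₂ i, g₂ j⟫_𝕜).det‖ ≤
      (∑ i, ∑ j, ‖⟪f₁ i, g₁ j⟫_𝕜 - ⟪f₂ i, g₂ j⟫_𝕜‖) * (Real.sqrt 2 * κf * κg) ^ m := by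
  set A : Matrix (Fin (m + 1)) (Fin (m + 1)) 𝕜 := Matrix.of fun i j => ⟪f₁ i, g₁ j⟫_𝕜 with hA
  set B : Matrix (Fin (m + 1)) (Fin (m + 1)) 𝕜 := Matrix.of fun i j => ⟪f₂ i, g₂ j⟫_𝕜 with hB
  have hκf : 0 ≤ κf := (norm_nonneg _).trans (hf₁ 0)
  have hκg : 0 ≤ κg := (norm_nonneg _).trans (hg₁ 0)
  rw [det_sub_det_eq_sum_hybrid A B, Finset.sum_mul]
  refine (norm_sum_le _ _).trans (sum_le_sum fun k _ => ?_)
  -- Laplace expansion of the difference row `k`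
  rw [det_succ_row _ k, Finset.sum_mul]
  refine (norm_sum_le _ _).trans (sum_le_sum fun j _ => ?_)
  have hrow : (((Matrix.of fun (i j : Fin (m + 1)) => if (i : ℕ) < (k : ℕ) then A i j else B i j)).updateRow k (A k - B k)) k j = ⟪f₁ k, g₁ j⟫_𝕜 - ⟪f₂ k, g₂ j⟫_𝕜 := by
    simp [hA, hB]
  -- the minor is a hybrid Gram minor
  have hminor : (((Matrix.of fun (i j : Fin (m + 1)) => if (i : ℕ) < (k : ℕ) then A i j else B i j)).updateRow k (A k - B k)).submatrix k.succAbove j.succAbove =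
      Matrix.of fun r c => if ((k.succAbove r : Fin (m + 1)) : ℕ) < k then ⟪f₁ (k.succAbove r), g₁ (j.succAbove c)⟫_𝕜
        else ⟪f₂ (k.succAbove r), g₂ (j.succAbove c)⟫_𝕜 := by
    ext r c
    simp only [submatrix_apply, of_apply, updateRow_ne (Fin.succAbove_ne k r), hA, hB]
  rw [hrow, hminor, norm_mul, norm_mul, norm_pow, norm_neg, norm_one, one_pow, one_mul]
  exact mul_le_mul_of_nonneg_left
    (norm_det_inner_hybridMinor_le f₁ g₁ f₂ g₂ hf₁ hf₂ hg₁ hg₂ hκf hκg _ _ _) (norm_nonneg _)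

/-- **The difference of two Gram determinants**, `n × n` form with exponent `n − 1` (for `n = 0` both determinants are `1`).
[cite: BenfattoGiulianiMastropietro2006, (2.80)] -/
theorem norm_det_inner_sub_det_inner_le {n : ℕ} (f₁ g₁ : Fin n → E₁) (f₂ g₂ : Fin n → E₂) {κf κg : ℝ}
    (hf₁ : ∀ i, ‖f₁ i‖ ≤ κf) (hf₂ : ∀ i, ‖f₂ i‖ ≤ κf) (hg₁ : ∀ j, ‖g₁ j‖ ≤ κg) (hg₂ : ∀ j, ‖g₂ j‖ ≤ κg) :
    ‖(Matrix.of fun i j => ⟪f₁ i, g₁ j⟫_𝕜).det - (Matrix.of fun i j => ⟪f₂ i, g₂ j⟫_𝕜).det‖ ≤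
      (∑ i, ∑ j, ‖⟪f₁ i, g₁ j⟫_𝕜 - ⟪f₂ i, g₂ j⟫_𝕜‖) * (Real.sqrt 2 * κf * κg) ^ (n - 1) := by
  cases n with
  | zero => simp
  | succ m => simpa using norm_det_inner_sub_det_inner_le_succ f₁ g₁ f₂ g₂ hf₁ hf₂ hg₁ hg₂

/-- **Uniform entrywise form**: if every entry differs by at most `δ`, then `‖det − det‖ ≤ n²·δ·(√2·κf·κg)^{n−1}`.
[cite: BenfattoGiulianiMastropietro2006, (2.80)] -/
theorem norm_det_inner_sub_det_inner_le_of_forall_le {n : ℕ} (f₁ g₁ : Fin n → E₁) (f₂ g₂ : Fin n → E₂) {κf κg δ : ℝ}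
    (hf₁ : ∀ i, ‖f₁ i‖ ≤ κf) (hf₂ : ∀ i, ‖f₂ i‖ ≤ κf) (hg₁ : ∀ j, ‖g₁ j‖ ≤ κg) (hg₂ : ∀ j, ‖g₂ j‖ ≤ κg)
    (hδ : ∀ i j, ‖⟪f₁ i, g₁ j⟫_𝕜 - ⟪f₂ i, g₂ j⟫_𝕜‖ ≤ δ) :
    ‖(Matrix.of fun i j => ⟪f₁ i, g₁ j⟫_𝕜).det - (Matrix.of fun i j => ⟪f₂ i, g₂ j⟫_𝕜).det‖ ≤
      (n : ℝ) ^ 2 * δ * (Real.sqrt 2 * κf * κg) ^ (n - 1) := by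
  refine (norm_det_inner_sub_det_inner_le f₁ g₁ f₂ g₂ hf₁ hf₂ hg₁ hg₂).trans ?_
  have hpow : 0 ≤ (Real.sqrt 2 * κf * κg) ^ (n - 1) := by
    rcases Nat.eq_zero_or_pos n with hn | hn
    · subst hn; simp
    · have hκf : 0 ≤ κf := (norm_nonneg _).trans (hf₁ ⟨0, hn⟩)
      have hκg : 0 ≤ κg := (norm_nonneg _).trans (hg₁ ⟨0, hn⟩)
      positivity
  refine mul_le_mul_of_nonneg_right ?_ hpow
  calc ∑ i, ∑ j, ‖⟪f₁ i, g₁ j⟫_𝕜 - ⟪f₂ i, g₂ j⟫_𝕜‖ ≤ ∑ _i : Fin n, ∑ _j : Fin n, δ :=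
        sum_le_sum fun i _ => sum_le_sum fun j _ => hδ i j
    _ = (n : ℝ) ^ 2 * δ := by simp [sum_const, card_univ, Fintype.card_fin]; ring

end Literature.Analysis.Matrix
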